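import Summits.SmoothPoincare4.SmoothPoincare4.Theses.EntropyRung
import Summits.SmoothPoincare4.SmoothPoincare4.Theorems.EntropyRungSubcylindricalExistenceSphereChart
import Literature.Geometry.Riemannian.RoundSphereProofs
import Literature.Geometry.Riemannian.AubinYamabeSphereEuclidean
import HarnessLib

/-!
# The cone pair `(ι, σ)` identifying `ℝ⁴` with `S⁴ ∖ {p}`
(witness helper `helper_sphereConePair` of the `S⁴` instance of the transfer stub
`stub_coneCoreExistence` of line `fat-conical-core-avr-logsobolev`, crux
`EntropyRung.SubcylindricalExistence`, item stmt-SmoothPoincare4-10871)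

For `p` on Mathlib's unit sphere `S⁴ = Metric.sphere (0 : EuclideanSpace ℝ (Fin 5)) 1` let
`c := extChartAt (𝓡 4) (-p)` be the extended chart at the antipode `-p`; it is the stereographic
projection *from* `p` (`chartAt (-p) = stereographic' 4 (-(-p))`), with source `{p}ᶜ`
(`stereographic'_source`) and target all of `ℝ⁴` (`stereographic'_target`). The cone pair of the
witness is

* `ι u := c⁻¹ (4 • u) : ℝ⁴ → S⁴` and `σ x := 4⁻¹ • c x : S⁴ → ℝ⁴`,

and we record: `ι` is smooth (`contMDiff_extChartAt_symm_sphere` composed with the dilation),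
injective, an immersion (`injective_mfderiv_extChartAt_symm_sphere` and the chain rule), with
`range ι = {p}ᶜ`; `σ` is smooth on `{p}ᶜ` (`contMDiffOn_extChartAt`); and `σ ∘ ι = id`,
`ι ∘ σ = id` on `{p}ᶜ` (`PartialEquiv.right_inv` / `left_inv`).

All folklore (Lee 2018, Ch. 1 and Ch. 3, stereographic coordinates); no definitions, no named
facts.
-/

noncomputable section

-- the registered namespace `Summit.SmoothPoincare4.SmoothPoincare4.Theorems` repeats a component
set_option linter.dupNamespace false

open scoped Manifold ContDiff Topology ENNReal NNReal ContinuousMap RealInnerProductSpace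
-- Mathlib's scoped instance `Fact (finrank ℝ (EuclideanSpace ℝ (Fin n)) = n)`, feeding the
-- `[Fact (finrank ℝ V = n + 1)]` hypotheses of the sphere API
open scoped EuclideanSpace
open Set Filter MeasureTheory Function
open Literature.Geometry.Lorentzian Literature.Geometry.Riemannian

namespace Summit.SmoothPoincare4.SmoothPoincare4.Theorems

namespace SphereConePair

/-- The source of the extended chart of `S⁴` at `-p` (stereographic projection from `p`) is
`{p}ᶜ`. [folklore] -/
theorem extChartAt_neg_source (p : Metric.sphere (0 : EuclideanSpace ℝ (Fin 5)) 1) :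
    (extChartAt (𝓡 4) (-p)).source = {p}ᶜ := by
  rw [extChartAt_source]
  change (stereographic' 4 (-(-p))).source = {p}ᶜ
  rw [stereographic'_source, neg_neg]

/-- The target of the extended chart of `S⁴` at `-p` is all of `ℝ⁴`; in particular every
`y : ℝ⁴` lies in it. [folklore] -/
theorem mem_extChartAt_neg_target (p : Metric.sphere (0 : EuclideanSpace ℝ (Fin 5)) 1)
    (y : EuclideanSpace ℝ (Fin 4)) : y ∈ (extChartAt (𝓡 4) (-p)).target := by
  rw [RoundClauseEuclidean.extChartAt_target_sphere]
  exact mem_univ y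

/-- `σ ∘ ι = id`: `4⁻¹ • c (c⁻¹ (4 • q)) = q` for the chart `c` at `-p`. [folklore] -/
theorem sigma_iota (p : Metric.sphere (0 : EuclideanSpace ℝ (Fin 5)) 1)
    (q : EuclideanSpace ℝ (Fin 4)) :
    (4 : ℝ)⁻¹ • extChartAt (𝓡 4) (-p) ((extChartAt (𝓡 4) (-p)).symm ((4 : ℝ) • q)) = q := by
  rw [(extChartAt (𝓡 4) (-p)).right_inv (mem_extChartAt_neg_target p _),
    inv_smul_smul₀ (four_ne_zero' ℝ)]

/-- `ι ∘ σ = id` off the pole: `c⁻¹ (4 • 4⁻¹ • c x) = x` for `x ≠ p`. [folklore] -/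
theorem iota_sigma (p : Metric.sphere (0 : EuclideanSpace ℝ (Fin 5)) 1)
    {x : Metric.sphere (0 : EuclideanSpace ℝ (Fin 5)) 1} (hx : x ≠ p) :
    (extChartAt (𝓡 4) (-p)).symm ((4 : ℝ) • ((4 : ℝ)⁻¹ • extChartAt (𝓡 4) (-p) x)) = x := by
  rw [smul_inv_smul₀ (four_ne_zero' ℝ)]
  apply (extChartAt (𝓡 4) (-p)).left_inv
  rw [extChartAt_neg_source]
  exact hx

/-- `ι = c⁻¹ ∘ (4 • ·)` is smooth on `ℝ⁴`. [folklore] -/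
theorem contMDiff_iota (p : Metric.sphere (0 : EuclideanSpace ℝ (Fin 5)) 1) :
    ContMDiff (𝓡 4) (𝓡 4) ∞
      (fun u : EuclideanSpace ℝ (Fin 4) ↦ (extChartAt (𝓡 4) (-p)).symm ((4 : ℝ) • u)) :=
  (contMDiff_extChartAt_symm_sphere (EuclideanSpace ℝ (Fin 5)) (-p) ∞).comp
    (contDiff_const_smul (4 : ℝ)).contMDiff

/-- `σ = 4⁻¹ • c` is smooth on the chart domain `{p}ᶜ`. [folklore] -/
theorem contMDiffOn_sigma (p : Metric.sphere (0 : EuclideanSpace ℝ (Fin 5)) 1) :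
    ContMDiffOn (𝓡 4) (𝓡 4) ∞
      (fun x : Metric.sphere (0 : EuclideanSpace ℝ (Fin 5)) 1 ↦ (4 : ℝ)⁻¹ • extChartAt (𝓡 4) (-p) x)
      {p}ᶜ := by
  have h : ContMDiffOn (𝓡 4) 𝓘(ℝ, EuclideanSpace ℝ (Fin 4)) ∞ (extChartAt (𝓡 4) (-p)) {p}ᶜ := by
    rw [← extChartAt_neg_source p, extChartAt_source]
    exact contMDiffOn_extChartAt
  exact (contDiff_const_smul (4 : ℝ)⁻¹).contMDiff.comp_contMDiffOn h

/-- The dilation `u ↦ 4 • u` of `ℝ⁴` has derivative `4 • id` (as a map of manifolds).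
[folklore] -/
theorem hasMFDerivAt_four_smul (q : EuclideanSpace ℝ (Fin 4)) :
    HasMFDerivAt (𝓡 4) (𝓡 4) (fun u : EuclideanSpace ℝ (Fin 4) ↦ (4 : ℝ) • u) q
      ((4 : ℝ) • ContinuousLinearMap.id ℝ (EuclideanSpace ℝ (Fin 4))) :=
  ((hasFDerivAt_id q).const_smul (4 : ℝ)).hasMFDerivAt

/-- Chain rule for `ι = c⁻¹ ∘ (4 • ·)`, applied to a vector: `dι_q v = d(c⁻¹)_{4q} (4 • v)`.
[folklore] -/
theorem mfderiv_iota_apply (p : Metric.sphere (0 : EuclideanSpace ℝ (Fin 5)) 1)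
    (q v : EuclideanSpace ℝ (Fin 4)) :
    mfderiv (𝓡 4) (𝓡 4)
        (fun u : EuclideanSpace ℝ (Fin 4) ↦ (extChartAt (𝓡 4) (-p)).symm ((4 : ℝ) • u)) q v =
      mfderiv (𝓡 4) (𝓡 4) (extChartAt (𝓡 4) (-p)).symm ((4 : ℝ) • q) ((4 : ℝ) • v) := by
  have hd : MDifferentiableAt (𝓡 4) (𝓡 4) (extChartAt (𝓡 4) (-p)).symm ((4 : ℝ) • q) :=
    (contMDiff_extChartAt_symm_sphere (EuclideanSpace ℝ (Fin 5)) (-p) 1).mdifferentiableAt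
      one_ne_zero
  exact DFunLike.congr_fun (hd.hasMFDerivAt.comp q (hasMFDerivAt_four_smul q)).mfderiv v

/-- `ι` is an immersion: `dι_q` is injective for every `q` (`d(c⁻¹)` is injective,
`injective_mfderiv_extChartAt_symm_sphere`, and so is `4 • id`). [folklore] -/
theorem injective_mfderiv_iota (p : Metric.sphere (0 : EuclideanSpace ℝ (Fin 5)) 1)
    (q : EuclideanSpace ℝ (Fin 4)) :
    Injective (mfderiv (𝓡 4) (𝓡 4)
      (fun u : EuclideanSpace ℝ (Fin 4) ↦ (extChartAt (𝓡 4) (-p)).symm ((4 : ℝ) • u)) q) := by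
  intro x y hxy
  rw [mfderiv_iota_apply, mfderiv_iota_apply] at hxy
  have hinj : Injective (mfderiv (𝓡 4) (𝓡 4) (extChartAt (𝓡 4) (-p)).symm ((4 : ℝ) • q)) :=
    injective_mfderiv_extChartAt_symm_sphere (EuclideanSpace ℝ (Fin 5)) (-p) ((4 : ℝ) • q)
  exact smul_right_injective (EuclideanSpace ℝ (Fin 4)) (four_ne_zero' ℝ) (hinj hxy)

/-- `range ι = {p}ᶜ`: the inverse chart maps `ℝ⁴ = target` onto `source = {p}ᶜ`. [folklore] -/
theorem range_iota (p : Metric.sphere (0 : EuclideanSpace ℝ (Fin 5)) 1) :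
    range (fun u : EuclideanSpace ℝ (Fin 4) ↦ (extChartAt (𝓡 4) (-p)).symm ((4 : ℝ) • u)) =
      {p}ᶜ := by
  ext x
  constructor
  · rintro ⟨u, rfl⟩
    rw [← extChartAt_neg_source p]
    exact (extChartAt (𝓡 4) (-p)).map_target (mem_extChartAt_neg_target p _)
  · intro hx
    exact ⟨(4 : ℝ)⁻¹ • extChartAt (𝓡 4) (-p) x, iota_sigma p hx⟩

end SphereConePair

open SphereConePair in
/-- **Witness helper — the cone pair of `S⁴ ∖ {p} ≅ ℝ⁴`.** For every `p ∈ S⁴ ⊂ ℝ⁵`, with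
`ι u := (extChartAt (𝓡 4) (-p))⁻¹ (4 • u)` and `σ x := 4⁻¹ • extChartAt (𝓡 4) (-p) x`:
`ι` is smooth, injective, an immersion, with range `{p}ᶜ`; `σ` is smooth on `{p}ᶜ`; and
`σ ∘ ι = id`, `ι ∘ σ = id` on `{p}ᶜ` (registered form). [folklore] -/
theorem helper_sphereConePair :
    ∀ (p : Metric.sphere (0 : EuclideanSpace ℝ (Fin 5)) 1), ContMDiff (𝓡 4) (𝓡 4) ∞ (fun u :
      EuclideanSpace ℝ (Fin 4) ↦ (extChartAt (𝓡 4) (-p)).symm ((4 : ℝ) • u)) ∧ Injective (fun u :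
      EuclideanSpace ℝ (Fin 4) ↦ (extChartAt (𝓡 4) (-p)).symm ((4 : ℝ) • u)) ∧ (∀ q : EuclideanSpace
      ℝ (Fin 4), Injective (mfderiv (𝓡 4) (𝓡 4) (fun u : EuclideanSpace ℝ (Fin 4) ↦ (extChartAt (𝓡
      4) (-p)).symm ((4 : ℝ) • u)) q)) ∧ range (fun u : EuclideanSpace ℝ (Fin 4) ↦ (extChartAt (𝓡 4)
      (-p)).symm ((4 : ℝ) • u)) = {p}ᶜ ∧ ContMDiffOn (𝓡 4) (𝓡 4) ∞ (fun x : Metric.sphere (0 :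
      EuclideanSpace ℝ (Fin 5)) 1 ↦ (4 : ℝ)⁻¹ • extChartAt (𝓡 4) (-p) x) {p}ᶜ ∧ (∀ q :
      EuclideanSpace ℝ (Fin 4), (4 : ℝ)⁻¹ • extChartAt (𝓡 4) (-p) ((extChartAt (𝓡 4) (-p)).symm ((4
      : ℝ) • q)) = q) ∧ (∀ x : Metric.sphere (0 : EuclideanSpace ℝ (Fin 5)) 1, x ≠ p → (extChartAt
      (𝓡 4) (-p)).symm ((4 : ℝ) • ((4 : ℝ)⁻¹ • extChartAt (𝓡 4) (-p) x)) = x) := by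
  intro p
  refine ⟨contMDiff_iota p, ?_, injective_mfderiv_iota p, range_iota p, contMDiffOn_sigma p,
    sigma_iota p, fun x hx ↦ iota_sigma p hx⟩
  -- `σ` is a left inverse of `ι`
  exact LeftInverse.injective
    (g := fun x : Metric.sphere (0 : EuclideanSpace ℝ (Fin 5)) 1 ↦
      (4 : ℝ)⁻¹ • extChartAt (𝓡 4) (-p) x)
    (sigma_iota p)

end Summit.SmoothPoincare4.SmoothPoincare4.Theorems

end
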